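import Literature.Probability.LatticeModels.OSReconstructionMeasure
import Literature.MathematicalPhysics.QuantumFieldTheory.LatticeMassGap
import HarnessLib

/-!
# Osterwalder–Schrader reconstruction for reflection-positive lattice measures on `ℤ^d`

The lattice instantiation of `OSReconstructionMeasure.lean` in the setting of `LatticeMassGap.lean` (time reflection
between sites `latticeTimeReflection d : x₀ ↦ −1 − x₀`, unit time shift `latticeTimeShift d S`, positive-time
σ-algebra `positiveTimeEvents d S`): a probability measure on configurations `ℤ^d → S` that is reflection invariant
(`IsReflectionInvariant`), shift invariant and reflection positive (`IsReflectionPositive` for the half `{0 ≤ x₀}`)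
satisfies `IsRPMeasureData` (`isRPMeasureData_lattice` — the one computation is `shift ∘ reflect ∘ shift = reflect`),
hence is REALISED in the sense of `IsOSRealisation` with the two-step time shift and the positive transfer operator
`T = S̄²` (`lattice_isOSRealisation_two_step`).  So the hypothesis "`(H, ι, D)` realises `μ`" of
`latticeClustering_iff_gap` and its kin is inhabited for every RP lattice measure (two-step form), by construction
rather than by assumption (Osterwalder–Seiler 1978 §2; Glimm–Jaffe 1987 §6.1 Thm. 6.1.3). [cite: OsterwalderSeiler1978, §2]
[cite: GlimmJaffe1987, §6.1 Thm. 6.1.3]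
-/

noncomputable section

namespace Literature.MathematicalPhysics.QuantumFieldTheory

open MeasureTheory Literature.Probability.LatticeModels

section LatticeOS

variable {d : ℕ} [NeZero d] {S : Type*} [MeasurableSpace S]

/-- **Reflection-positive measure data for a lattice measure on `ℤ^d`**: a probability measure on configurations
`ℤ^d → S` that is invariant under the time reflection between sites and under the unit time shift, and reflection
positive for the half `{0 ≤ x₀}`, satisfies `IsRPMeasureData` for `(configReflect (latticeTimeReflection d),
latticeTimeShift d S, positiveTimeEvents d S)`. [cite: OsterwalderSeiler1978, §2] -/
theorem isRPMeasureData_lattice (μ : Measure (Site d → S)) [IsProbabilityMeasure μ]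
    (hinv : IsReflectionInvariant μ (latticeTimeReflection d))
    (hshift : MeasurePreserving (latticeTimeShift d S) μ μ)
    (hRP : IsReflectionPositive μ (latticeTimeReflection d) (positiveTimeSites d)) :
    IsRPMeasureData μ (configReflect (latticeTimeReflection d)) (latticeTimeShift d S)
      (positiveTimeEvents d S) where
  isProbabilityMeasure := inferInstance
  le := MeasureTheory.cylinderEvents_le_pi
  measurable_reflect := measurable_configReflect _
  reflect_involutive := configReflect_configReflect_of_involutive (latticeTimeReflection_involutive d)
  measurePreserving_reflect := ⟨measurable_configReflect _, hinv⟩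
  measurable_shift := (latticeTimeShift d S).measurable
  measurePreserving_shift := hshift
  shift_reflect_shift σ := by
    ext x
    simp only [latticeTimeShift_apply, configReflect_apply, latticeTimeReflection_apply]
    congr 1
    ext j
    by_cases hj : j = 0
    · subst hj; simp; ring
    · simp [hj]
  measurable_comp_shift G hG := measurable_comp_latticeTimeShift d S hG
  rp F hF := hRP F hF.1 hF.2

/-- **Osterwalder–Schrader reconstruction for a reflection-positive lattice measure on `ℤ^d`, two-step form**: the
measure is realised (`IsOSRealisation`) with the two-step time shift by the OS Hilbert space of its reflected pairing,
the OS map and the positive transfer operator `T = S̄²`. [cite: OsterwalderSeiler1978, §2] [cite: GlimmJaffe1987, §6.1 Thm. 6.1.3] -/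
theorem lattice_isOSRealisation_two_step (μ : Measure (Site d → S)) [IsProbabilityMeasure μ]
    (hinv : IsReflectionInvariant μ (latticeTimeReflection d))
    (hshift : MeasurePreserving (latticeTimeShift d S) μ μ)
    (hRP : IsReflectionPositive μ (latticeTimeReflection d) (positiveTimeSites d)) :
    IsOSRealisation μ (configReflect (latticeTimeReflection d)) (latticeTimeShift d S ∘ latticeTimeShift d S)
      (positiveTimeEvents d S) (rpMap (isRPMeasureData_lattice μ hinv hshift hRP).two_step)
      (rpTransferData (isRPMeasureData_lattice μ hinv hshift hRP).two_step
        (isRPMeasureData_lattice μ hinv hshift hRP).two_step_pos) :=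
  isOSRealisation_two_step (isRPMeasureData_lattice μ hinv hshift hRP)

end LatticeOS

end Literature.MathematicalPhysics.QuantumFieldTheory
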